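import Summits.CriticalPhenomena.PercolationContinuityZ3.Theorems.Transplant.SkelNegBParamsBridgeF
import Summits.CriticalPhenomena.PercolationContinuityZ3.Theorems.Transplant.SkelNegBParamsFaceY
import HarnessLib

/-!
# N1 params, chain of record `NegB`, part FramesF: THE y′-FACE START WINDOW AT THE WIDE BRIDGE, case same, BOTH HOP SIDES — origin
# `yLF σ σ_h` with `σ·yLF₀ = s_h·(c_lo + n_L) + v_L` (`s_h := σ·σ_h`; p1-g13's convention 01:39:09Z: bridge `B_F(σ_h)` in its own frame, origin absolute,
# one relative sign), half-width `qBF`, and hp-8/p1's `hxaY(s_h)` / `hxbY(σ_h)` (stmt-g15 2026-08-22; p5-g10 01:39:50Z arithmetic ✓)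
The origin is the core-centre origin of part FaceY shifted ALONG `u = (n_L, h_L)` (level-neutral: `Λ₁(u) = 0`), so `hxbY` keeps FaceY's bound (`hxbY_core` with
`v := n_L − RA′ + s_h·v_L`) and `hxaY(s_h)` lands exactly on `[−(n_L+v_L), 2RA′ − n_L − v_L] ∪ mirror ⊆ [−(n+v), n−v]` (`RA′ ≤ n_L`). Cases d/t: same recipe with
`(c₀, wF)` from `mem_core1_side_iff/top_iff` (successor file).
builds on p205010 (kernel theorem, internal audit signed; external expert review pending) — nothing in this file uses p205010; NOTHING is claimed about
the node `SamePDropOfSkeletonNeg₁` (OPEN; (F) blocked on `hlin` for p286999; additive closure adopted on accept, lead g7 01:38:43Z).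
Lane `prim-bschramm-*`, seat `prim-bschramm-stmt` (gen 15); helper file (`--supports stmt-CriticalPhenomena-4575 --as helper`); ledger HOME/prim-bschramm-stmt/NEG-PARAMS.md.
* `mem_core1F_same_iff`, `KS.qStarF/wStarF/qBF`, `qBF_spec`, **`KS.yLFs σ σh`**, `yLFs_zero`, **`hxaF_s`**, **`hxbF_s`**.
[cite: KozmaNitzan2024, §4 Lemma 11 (pp. 22–23)] [cite: MartineauTassion2017, §4.1]
-/

noncomputable section

open scoped Classical

namespace Summit.CriticalPhenomena.PercolationContinuityZ3.Theorems.Transplant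

namespace PlanarSkeletonNeg

namespace NegB

open Literature.Probability.Percolation Literature.Probability.LatticeModels SimpleGraph
open SkelConc (Consts)
open Skelφ (shearUnit shearUnit_pos)
open Skelφ.StepI (DataN)
open Neg

namespace KS

section Same

variable (κ : Consts) {V : Type} [DecidableEq V] [Countable V] {G : SimpleGraph V} [G.LocallyFinite] (Φ : PlanarSkeletonNeg G) (t : V)
  (p : unitInterval) (D : DataN V) (c mk : ℕ) (g f : ℕ)

/-- Core `1` of `bridgeSame σh` at the WIDE pair in coordinates: `x₀ ∈ [n_L − RA′ + nBF, n_L + RA′ + nBF]`, `x₁ ∈ [σh·h_L − RA′ + σh·hBF, σh·h_L + ℓ_L + RA′ + σh·hBF + ℓBF]`. [folklore] -/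
theorem mem_core1F_same_iff (σh : ℤ) (x : Site 2) :
    x ∈ Finset.Icc (Skelφ.bridgeSame σh (nL κ Φ t p D g f) (hL κ Φ t p D g f) (ℓL κ Φ t p D g f) (RA' κ Φ t p D mk) (nBF κ Φ t p D c mk) (hBF κ Φ t p D c mk) (ℓBF κ Φ t p D c mk)).core1Lo
        (Skelφ.bridgeSame σh (nL κ Φ t p D g f) (hL κ Φ t p D g f) (ℓL κ Φ t p D g f) (RA' κ Φ t p D mk) (nBF κ Φ t p D c mk) (hBF κ Φ t p D c mk) (ℓBF κ Φ t p D c mk)).core1Hi ↔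
      ((nL κ Φ t p D g f : ℤ) - RA' κ Φ t p D mk + nBF κ Φ t p D c mk ≤ x 0 ∧ x 0 ≤ (nL κ Φ t p D g f : ℤ) + RA' κ Φ t p D mk + nBF κ Φ t p D c mk) ∧
        (σh * hL κ Φ t p D g f - RA' κ Φ t p D mk + σh * hBF κ Φ t p D c mk ≤ x 1 ∧
          x 1 ≤ σh * hL κ Φ t p D g f + ℓL κ Φ t p D g f + RA' κ Φ t p D mk + (σh * hBF κ Φ t p D c mk + ℓBF κ Φ t p D c mk)) := by
  have hlo : (Skelφ.bridgeSame σh (nL κ Φ t p D g f) (hL κ Φ t p D g f) (ℓL κ Φ t p D g f) (RA' κ Φ t p D mk) (nBF κ Φ t p D c mk) (hBF κ Φ t p D c mk) (ℓBF κ Φ t p D c mk)).core1Lo =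
      Skelφ.pt ((nL κ Φ t p D g f : ℤ) - RA' κ Φ t p D mk + nBF κ Φ t p D c mk) (σh * hL κ Φ t p D g f - RA' κ Φ t p D mk + σh * hBF κ Φ t p D c mk) := by
    funext i; unfold ChainPlanar.BridgePrm.core1Lo Skelφ.bridgeSame
    fin_cases i <;> simp [Skelφ.pt]
  have hhi : (Skelφ.bridgeSame σh (nL κ Φ t p D g f) (hL κ Φ t p D g f) (ℓL κ Φ t p D g f) (RA' κ Φ t p D mk) (nBF κ Φ t p D c mk) (hBF κ Φ t p D c mk) (ℓBF κ Φ t p D c mk)).core1Hi =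
      Skelφ.pt ((nL κ Φ t p D g f : ℤ) + RA' κ Φ t p D mk + nBF κ Φ t p D c mk) (σh * hL κ Φ t p D g f + ℓL κ Φ t p D g f + RA' κ Φ t p D mk + (σh * hBF κ Φ t p D c mk + ℓBF κ Φ t p D c mk)) := by
    funext i; unfold ChainPlanar.BridgePrm.core1Hi Skelφ.bridgeSame
    fin_cases i <;> simp [Skelφ.pt]
  rw [hlo, hhi, Skelφ.mem_Icc_pt_iff]

/-- The β half-height of the wide core (+ slack): `q⋆F := ℓ_L/2 + ℓBF/2 + nBF + RA′ + 2`. [this work] -/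
def qStarF : ℕ := ℓL κ Φ t p D g f / 2 + ℓBF κ Φ t p D c mk / 2 + nBF κ Φ t p D c mk + RA' κ Φ t p D mk + 2

/-- The α half-width of the wide core (+ slack): `w⋆F := RA′ + ℓBF/2 + |hBF| + 6`. [this work] -/
def wStarF : ℕ := RA' κ Φ t p D mk + ℓBF κ Φ t p D c mk / 2 + (hBF κ Φ t p D c mk).natAbs + 6

/-- **The y′-face start half-width at the wide pair** `qBF := (n_L·q⋆F + |h_L|·w⋆F + n_L)/U_L + 1`. [this work] -/
def qBF : ℕ := (nL κ Φ t p D g f * qStarF κ Φ t p D c mk g f + (hL κ Φ t p D g f).natAbs * wStarF κ Φ t p D c mk + nL κ Φ t p D g f) /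
    shearUnit (nL κ Φ t p D g f) (hL κ Φ t p D g f) + 1

/-- `n_L·q⋆F + |h_L|·w⋆F + n_L ≤ qBF·U_L` (`1 ≤ n_L`). [folklore] -/
theorem qBF_spec (hn : 1 ≤ nL κ Φ t p D g f) :
    (nL κ Φ t p D g f : ℤ) * (qStarF κ Φ t p D c mk g f : ℤ) + |hL κ Φ t p D g f| * (wStarF κ Φ t p D c mk : ℤ) + nL κ Φ t p D g f ≤
      (qBF κ Φ t p D c mk g f : ℤ) * (shearUnit (nL κ Φ t p D g f) (hL κ Φ t p D g f) : ℤ) := by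
  have hU : 0 < shearUnit (nL κ Φ t p D g f) (hL κ Φ t p D g f) := by unfold Skelφ.shearUnit; omega
  set X := nL κ Φ t p D g f * qStarF κ Φ t p D c mk g f + (hL κ Φ t p D g f).natAbs * wStarF κ Φ t p D c mk + nL κ Φ t p D g f with hX
  have h1 : X ≤ (X / shearUnit (nL κ Φ t p D g f) (hL κ Φ t p D g f) + 1) * shearUnit (nL κ Φ t p D g f) (hL κ Φ t p D g f) := by
    rw [Nat.add_mul, one_mul]; have := Nat.lt_div_mul_add (a := X) hU; omega
  have h2 : ((X : ℕ) : ℤ) ≤ (qBF κ Φ t p D c mk g f : ℤ) * (shearUnit (nL κ Φ t p D g f) (hL κ Φ t p D g f) : ℤ) := by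
    unfold qBF; rw [← hX]; exact_mod_cast h1
  have e : ((X : ℕ) : ℤ) = (nL κ Φ t p D g f : ℤ) * (qStarF κ Φ t p D c mk g f : ℤ) + |hL κ Φ t p D g f| * (wStarF κ Φ t p D c mk : ℤ) + nL κ Φ t p D g f := by
    rw [hX]; push_cast [Int.natCast_natAbs]; ring
  linarith

/-- **THE y′-FACE ORIGIN AT THE WIDE BRIDGE, case same, hop side `σh`** (run sign `σ`, `s_h = σ·σh`): α-coordinate `σh·(c_lo + n_L) + σ·v_L`, β-coordinate the core's
β-centre corrected by `⌊σh·h_L·(n_L − RA′ + σσh·v_L)/n_L⌋` (shift along `u`). [this work] -/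
def yLFs (σ σh : ℤ) : Site 2 :=
  Skelφ.pt (σh * ((nL κ Φ t p D g f : ℤ) + nBF κ Φ t p D c mk - RA' κ Φ t p D mk + nL κ Φ t p D g f) + σ * vL κ Φ t p D g f)
    ((σh * (hL κ Φ t p D g f + hBF κ Φ t p D c mk) + ((ℓL κ Φ t p D g f : ℤ) + ℓBF κ Φ t p D c mk) / 2) +
      σh * hL κ Φ t p D g f * ((nL κ Φ t p D g f : ℤ) - RA' κ Φ t p D mk + σ * σh * vL κ Φ t p D g f) / (nL κ Φ t p D g f : ℤ))

/-- `σ·yLFs₀ = s_h·(c_lo + n_L) + v_L` with `c_lo = n_L + nBF − RA′`, `s_h = σ·σh` (`σ = ±1`). [folklore] -/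
theorem yLFs_zero {σ : ℤ} (hσ : σ = 1 ∨ σ = -1) (σh : ℤ) :
    σ * yLFs κ Φ t p D c mk g f σ σh 0 = σ * σh * ((nL κ Φ t p D g f : ℤ) + nBF κ Φ t p D c mk - RA' κ Φ t p D mk + nL κ Φ t p D g f) + vL κ Φ t p D g f := by
  have hσsq : σ * σ = 1 := by rcases hσ with rfl | rfl <;> norm_num
  unfold yLFs; rw [Skelφ.pt_zero]; linear_combination (vL κ Φ t p D g f) * hσsq

end Same

section SameAt

variable (κ : Consts) {V : Type} [DecidableEq V] [Countable V] {G : SimpleGraph V} [G.LocallyFinite] (Φ : PlanarSkeletonNeg G) (t : V)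
  (p : unitInterval) (D : DataN V) (c mk : ℕ) (gx fx : Neg.FSlot)

/-- **`hxaY(s_h)`, case same, wide pair**: `−(n_L + v_L) ≤ s_h·y₀ − σ·yLFs₀ ≤ n_L − v_L` on core 1 of `bridgeSame σh` (`s_h = σ·σh`). [folklore] -/
theorem hxaF_s (hN : EqNumL κ Φ t p D (gT mk gx κ Φ t p D) (fT mk fx κ Φ t p D)) {σ σh : ℤ} (hσ : σ = 1 ∨ σ = -1) (hσh : σh = 1 ∨ σh = -1) :
    ∀ y ∈ Finset.Icc (Skelφ.bridgeSame σh (nL κ Φ t p D (gT mk gx κ Φ t p D) (fT mk fx κ Φ t p D)) (hL κ Φ t p D (gT mk gx κ Φ t p D) (fT mk fx κ Φ t p D))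
          (ℓL κ Φ t p D (gT mk gx κ Φ t p D) (fT mk fx κ Φ t p D)) (RA' κ Φ t p D mk) (nBF κ Φ t p D c mk) (hBF κ Φ t p D c mk) (ℓBF κ Φ t p D c mk)).core1Lo
        (Skelφ.bridgeSame σh (nL κ Φ t p D (gT mk gx κ Φ t p D) (fT mk fx κ Φ t p D)) (hL κ Φ t p D (gT mk gx κ Φ t p D) (fT mk fx κ Φ t p D))
          (ℓL κ Φ t p D (gT mk gx κ Φ t p D) (fT mk fx κ Φ t p D)) (RA' κ Φ t p D mk) (nBF κ Φ t p D c mk) (hBF κ Φ t p D c mk) (ℓBF κ Φ t p D c mk)).core1Hi,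
      -((((nL κ Φ t p D (gT mk gx κ Φ t p D) (fT mk fx κ Φ t p D) : ℤ) + vL κ Φ t p D (gT mk gx κ Φ t p D) (fT mk fx κ Φ t p D)).toNat : ℕ) : ℤ) ≤
          σ * σh * y 0 - σ * yLFs κ Φ t p D c mk (gT mk gx κ Φ t p D) (fT mk fx κ Φ t p D) σ σh 0 ∧
        σ * σh * y 0 - σ * yLFs κ Φ t p D c mk (gT mk gx κ Φ t p D) (fT mk fx κ Φ t p D) σ σh 0 ≤
          ((((nL κ Φ t p D (gT mk gx κ Φ t p D) (fT mk fx κ Φ t p D) : ℤ) - vL κ Φ t p D (gT mk gx κ Φ t p D) (fT mk fx κ Φ t p D)).toNat : ℕ) : ℤ) := by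
  intro y hy
  rw [mem_core1F_same_iff] at hy
  obtain ⟨⟨h0l, h0u⟩, -⟩ := hy
  obtain ⟨hv1, hv2⟩ := abs_le.1 hN.v_le
  have hRn : (RA' κ Φ t p D mk : ℤ) ≤ nL κ Φ t p D (gT mk gx κ Φ t p D) (fT mk fx κ Φ t p D) := by exact_mod_cast hRn_R κ Φ t p D mk gx fx
  rw [yLFs_zero κ Φ t p D c mk _ _ hσ, Int.toNat_of_nonneg (by linarith), Int.toNat_of_nonneg (by linarith)]
  have hs : σ * σh = 1 ∨ σ * σh = -1 := by
    rcases hσ with rfl | rfl <;> rcases hσh with rfl | rfl <;> norm_num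
  rcases hs with hs | hs <;> rw [hs] <;> constructor <;> linarith

/-- **`hxbY(σh)`, case same, wide pair** (`qB := qBF`): `|σ·(n_L·(y₁ − yLFs₁) − h_L·(σh·y₀ − yLFs₀))| + U_L ≤ (qBF + 1)·U_L`. [folklore] -/
theorem hxbF_s (hN : EqNumL κ Φ t p D (gT mk gx κ Φ t p D) (fT mk fx κ Φ t p D)) {σ σh : ℤ} (hσ : σ = 1 ∨ σ = -1) (hσh : σh = 1 ∨ σh = -1) :
    ∀ y ∈ Finset.Icc (Skelφ.bridgeSame σh (nL κ Φ t p D (gT mk gx κ Φ t p D) (fT mk fx κ Φ t p D)) (hL κ Φ t p D (gT mk gx κ Φ t p D) (fT mk fx κ Φ t p D))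
          (ℓL κ Φ t p D (gT mk gx κ Φ t p D) (fT mk fx κ Φ t p D)) (RA' κ Φ t p D mk) (nBF κ Φ t p D c mk) (hBF κ Φ t p D c mk) (ℓBF κ Φ t p D c mk)).core1Lo
        (Skelφ.bridgeSame σh (nL κ Φ t p D (gT mk gx κ Φ t p D) (fT mk fx κ Φ t p D)) (hL κ Φ t p D (gT mk gx κ Φ t p D) (fT mk fx κ Φ t p D))
          (ℓL κ Φ t p D (gT mk gx κ Φ t p D) (fT mk fx κ Φ t p D)) (RA' κ Φ t p D mk) (nBF κ Φ t p D c mk) (hBF κ Φ t p D c mk) (ℓBF κ Φ t p D c mk)).core1Hi,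
      |σ * ((nL κ Φ t p D (gT mk gx κ Φ t p D) (fT mk fx κ Φ t p D) : ℤ) * (y 1 - yLFs κ Φ t p D c mk (gT mk gx κ Φ t p D) (fT mk fx κ Φ t p D) σ σh 1) -
            hL κ Φ t p D (gT mk gx κ Φ t p D) (fT mk fx κ Φ t p D) * (σh * y 0 - yLFs κ Φ t p D c mk (gT mk gx κ Φ t p D) (fT mk fx κ Φ t p D) σ σh 0))| +
          (shearUnit (nL κ Φ t p D (gT mk gx κ Φ t p D) (fT mk fx κ Φ t p D)) (hL κ Φ t p D (gT mk gx κ Φ t p D) (fT mk fx κ Φ t p D)) : ℤ) ≤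
        ((qBF κ Φ t p D c mk (gT mk gx κ Φ t p D) (fT mk fx κ Φ t p D) : ℤ) + 1) *
          (shearUnit (nL κ Φ t p D (gT mk gx κ Φ t p D) (fT mk fx κ Φ t p D)) (hL κ Φ t p D (gT mk gx κ Φ t p D) (fT mk fx κ Φ t p D)) : ℤ) := by
  intro y hy
  rw [mem_core1F_same_iff] at hy
  obtain ⟨⟨h0l, h0u⟩, ⟨h1l, h1u⟩⟩ := hy
  obtain ⟨hn1, -⟩ := one_le_of_eqNumL κ Φ t p D _ _ hN
  set n := nL κ Φ t p D (gT mk gx κ Φ t p D) (fT mk fx κ Φ t p D) with hn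
  set h := hL κ Φ t p D (gT mk gx κ Φ t p D) (fT mk fx κ Φ t p D) with hh
  set ℓ := ℓL κ Φ t p D (gT mk gx κ Φ t p D) (fT mk fx κ Φ t p D) with hℓ
  set v := vL κ Φ t p D (gT mk gx κ Φ t p D) (fT mk fx κ Φ t p D) with hv
  have hspec := qBF_spec κ Φ t p D c mk (gT mk gx κ Φ t p D) (fT mk fx κ Φ t p D) hn1
  have hR0 : (0 : ℤ) ≤ (RA' κ Φ t p D mk : ℤ) := by positivity
  -- the core about (c₀, b₁) = (n + nBF, σh(h + hBF) + (ℓ + ℓBF)/2), half sizes (RA′, (ℓ+ℓBF)/2 + RA′ + 1)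
  have hd := Int.mul_ediv_add_emod ((ℓ : ℤ) + ℓBF κ Φ t p D c mk) 2
  have hm0 := Int.emod_nonneg ((ℓ : ℤ) + ℓBF κ Φ t p D c mk) (by norm_num : (2 : ℤ) ≠ 0)
  have hm1 := Int.emod_lt_of_pos ((ℓ : ℤ) + ℓBF κ Φ t p D c mk) (by norm_num : (0 : ℤ) < 2)
  have ha : |y 0 - ((n : ℤ) + nBF κ Φ t p D c mk)| ≤ (RA' κ Φ t p D mk : ℤ) := abs_le.2 ⟨by linarith, by linarith⟩
  have hb : |y 1 - (σh * (h + hBF κ Φ t p D c mk) + ((ℓ : ℤ) + ℓBF κ Φ t p D c mk) / 2)| ≤ ((ℓ : ℤ) + ℓBF κ Φ t p D c mk) / 2 + RA' κ Φ t p D mk + 1 := by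
    have e : σh * (h + hBF κ Φ t p D c mk) = σh * h + σh * hBF κ Φ t p D c mk := by ring
    rw [e, abs_le]; constructor <;> linarith
  -- `hxbY_core` in the σh-frame with the shifted `v' := n − RA′ + σσh·v`
  have key := hxbY_core (n := n) hn1 h ((n : ℤ) - RA' κ Φ t p D mk + σ * σh * v) hσh ha hb
  have hq' : ((ℓ : ℤ) + ℓBF κ Φ t p D c mk) / 2 + RA' κ Φ t p D mk + 1 ≤ (qStarF κ Φ t p D c mk (gT mk gx κ Φ t p D) (fT mk fx κ Φ t p D) : ℤ) := by
    unfold qStarF; push_cast; omega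
  have hw' : (RA' κ Φ t p D mk : ℤ) ≤ (wStarF κ Φ t p D c mk : ℤ) := by
    have ew : (wStarF κ Φ t p D c mk : ℤ) = (RA' κ Φ t p D mk : ℤ) + (ℓBF κ Φ t p D c mk : ℤ) / 2 + |hBF κ Φ t p D c mk| + 6 := by
      unfold wStarF; push_cast [Int.natCast_natAbs]; ring
    have h0 : (0 : ℤ) ≤ (ℓBF κ Φ t p D c mk : ℤ) / 2 := Int.ediv_nonneg (by positivity) (by norm_num)
    rw [ew]; linarith [abs_nonneg (hBF κ Φ t p D c mk)]
  have hn0 : (0 : ℤ) ≤ (n : ℤ) := by positivity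
  have e0 : yLFs κ Φ t p D c mk (gT mk gx κ Φ t p D) (fT mk fx κ Φ t p D) σ σh 0 = σh * (((n : ℤ) + nBF κ Φ t p D c mk) + ((n : ℤ) - RA' κ Φ t p D mk + σ * σh * v)) := by
    have hσh2 : σh * σh = 1 := by rcases hσh with rfl | rfl <;> norm_num
    unfold yLFs; rw [Skelφ.pt_zero]; linear_combination (-(σ * v)) * hσh2
  have e1 : yLFs κ Φ t p D c mk (gT mk gx κ Φ t p D) (fT mk fx κ Φ t p D) σ σh 1 =
      (σh * (h + hBF κ Φ t p D c mk) + ((ℓ : ℤ) + ℓBF κ Φ t p D c mk) / 2) + σh * h * ((n : ℤ) - RA' κ Φ t p D mk + σ * σh * v) / (n : ℤ) := by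
    unfold yLFs; rw [Skelφ.pt_one]
  -- |σ·X| = |σh·X|
  have hσabs : |σ| = 1 := by rcases hσ with rfl | rfl <;> norm_num
  have hσhabs : |σh| = 1 := by rcases hσh with rfl | rfl <;> norm_num
  have habs : ∀ X : ℤ, |σ * X| = |σh * X| := fun X => by rw [abs_mul, abs_mul, hσabs, hσhabs]
  rw [habs, e0, e1]
  have hmono : (n : ℤ) * (((ℓ : ℤ) + ℓBF κ Φ t p D c mk) / 2 + RA' κ Φ t p D mk + 1) + |h| * (RA' κ Φ t p D mk : ℤ) + n ≤
      (n : ℤ) * (qStarF κ Φ t p D c mk (gT mk gx κ Φ t p D) (fT mk fx κ Φ t p D) : ℤ) + |h| * (wStarF κ Φ t p D c mk : ℤ) + n := by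
    have := abs_nonneg h; nlinarith
  linarith

end SameAt

end KS

end NegB

end PlanarSkeletonNeg

end Summit.CriticalPhenomena.PercolationContinuityZ3.Theorems.Transplant

end
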